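import Literature.AlgebraicGeometry.Motives.HodgeStructureCentralizerSemisimple
import Literature.AlgebraicGeometry.Motives.HodgeStructureCentralizerBaseChange
import Literature.RingTheory.SimpleModule.SemisimpleBaseChange
import HarnessLib

/-!
# `C(A) ⊗_k K` IS A SEMISIMPLE `K`-ALGEBRA FOR EVERY FIELD `K ⊇ ℚ` — Remark 1.2 and Remark 1.6 ON `K`-POINTS: `C(H)(K)` is
# semisimple, its commutant in `End_K(K ⊗ V)` is `E_φ ⊗ K` (no `[HodgeTensorFacts]`), its centre is `Z(E_φ) ⊗ K = (E_φ ⊗ K) ∩ C(H)(K)`,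
# and `C(H)(K)` is simple iff `E_φ ⊗ K` is, with `dim_K (E_φ ⊗ K) · dim_K C(H)(K) = (dim V)²` (Milne 1999 §1 Rem. 1.2, 1.6, p. 644 L22–L24)

[topic AlgebraicGeometry/Motives]

Layer `Literature/AlgebraicGeometry/Motives`, lane `lit-hodgefound` (Track 2 foundations library; prover seat
`lit-hodgefound-p02`, generation 54, self-proposed row g54-#2). THEOREMS ONLY: no definition, no named fact (net debt `0`),
no instance, no notation.  Sequel of g54-#1 (`Motives/HodgeStructureCentralizerSemisimple`: over `ℚ`, `C(H)` is semisimple with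
centre `Z(E_φ)`) on `K`-POINTS, for every field `K ⊇ ℚ`: Milne's `S(A)` is an algebraic group whose `R`-points are cut out of
`C(A) ⊗_k R`, and «it is a reductive group … (cf. Weil 1960)» is a statement about `(C(A) ⊗_k K, †)` for all `K` — here: the
`K`-algebra `C(H)(K) ⊆ End_K(K ⊗_ℚ V)` (the tree's `K`-points of the centralizer, `Motives/HodgeStructureLefschetzGroupPoints`) is
SEMISIMPLE, because it is `K ⊗_ℚ C(H)` (Remark 1.6 literally, the tree's `exists_baseChange_centralizer_algEquiv`,
`Motives/HodgeStructureCentralizerBaseChange`) and a semisimple algebra over a field of characteristic `0` stays semisimple under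
extension of scalars (Milne's own argument for `End⁰(A) ⊗_ℚ k` in Remark 1.2, «whose centre is separable over `ℚ`»; the tree's
`Literature.RingTheory.SimpleModule.isSemisimpleRing_baseChange`).  Consequences, all on `K`-points and all WITHOUT the instance
hypothesis `[HodgeTensorFacts]` of the tree's `forall_centralizer_endAlg_baseChange_comm_iff_mem_span_baseChange_endAlg`:
Remark 1.2 (`Z_{End_K(K ⊗ V)}(C(H)(K)) = E_φ ⊗ K = K[a_K | a ∈ E_φ]`), the centre (`Z(C(H)(K)) = (E_φ ⊗ K) ∩ C(H)(K)`, with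
underlying `K`-module the `K`-span of the `z_K`, `z ∈ Z(E_φ) = E_φ ∩ C(H)` — «`Z(C'(A)) = C₀(A) ⊗ k'`»), and the simple case
(`C(H)(K)` simple iff `E_φ ⊗ K` simple, then `dim_K(E_φ ⊗ K) · dim_K C(H)(K) = (dim_ℚ V)²`; Voight Prop. 7.7.8 over `F = K` in the
central simple `End_K(K ⊗ V)`).

## The sources, verbatim

* J. S. Milne, *Lefschetz classes on abelian varieties*, Duke Math. J. 96 (1999) 639–675 [Milne1999LefschetzClasses] (held
  `paper:doi-10-1215-s0012-7094-99-09620-5`, folios 5–6 = pp. 643–644): **Remark 1.2** "Because `End⁰(A)` is a semisimple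
  `ℚ`-algebra whose centre is separable over `ℚ`, `End⁰(A) ⊗_ℚ k` is a semisimple `k`-algebra. Therefore, the centralizer of
  `C(A)` in `End_k(V(A))` is `End⁰(A) ⊗_ℚ k`."; p. 644 L16–L24 "`S(A)(R) = {γ ∈ C(A) ⊗_k R | γ†γ = 1}` […] It is a reductive group
  (not necessarily connected) over `k` whose nonabelian simple quotients are classical groups (cf. Weil 1960)."; **Remark 1.6**
  (p. 644 L29–L34) "If `C'(A)` and `S'(A)` denote the objects defined relative to [`H* ⊗_k k'`], then there are canonical
  isomorphisms `C'(A) ≅ C(A) ⊗_k k'`, `S'(A) ≅ S(A)_{/k'}`."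
* R. S. Pierce, *Associative Algebras* (GTM 88, 1982) [Pierce1982], §10.7 Cor. b with §10.6 Cor.: a finite-dimensional
  semisimple algebra over a field of characteristic `0` is separable, so remains semisimple under every extension of the base
  field — the tree's `Literature/RingTheory/SimpleModule/SemisimpleBaseChange`.
* Yu. G. Zarhin (2018) [Zarhin2018SuperellipticJacobians], §4 Thm. 4.1, and J. Voight, *Quaternion Algebras* [Voight2021], §7.7
  Prop. 7.7.8 (a), (b) — the tree's `Literature/RingTheory/CentralSimple/SemisimpleCentralizer`, `…/DoubleCentralizer` (as in g54-#1).

## Dictionary and what is proved (namespace `Literature.AlgebraicGeometry.Motives.HodgeStructure`)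

`C(H) = Subalgebra.centralizer ℚ (H.endAlg : Set (Module.End ℚ V))`, `C(H)(K) = Subalgebra.centralizer K ((· ⊗ K) '' E_φ)`,
`E_φ ⊗ K = Algebra.adjoin K {a_K | a ∈ E_φ}` with underlying `K`-module `span_K {a_K}` (the two spellings of the tree),
`a_K = a.baseChange K`; `H` polarizable, `V` finite-dimensional over `ℚ`, `K ⊇ ℚ` any field (any universe).

* §1 **`isSemisimpleRing_centralizer_endAlg_baseChange`** (`C(H)(K)` is a semisimple ring), `free_centralizer_endAlg_baseChange`.
* §2 REMARK 1.2 ON `K`-POINTS WITHOUT `[HodgeTensorFacts]`: `forall_centralizer_endAlg_baseChange_comm_iff_mem_span_baseChange_endAlg'`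
  (`f` commutes with every `c_K`, `c ∈ C(H)`, iff `f ∈ span_K {a_K}`), `centralizer_coe_adjoin_baseChange_endAlg_eq` (`C(H)(K)` is
  the commutant of the ALGEBRA `E_φ ⊗ K`), **`centralizer_centralizer_endAlg_baseChange_eq_adjoin`**
  (`Z_{End_K(K ⊗ V)}(C(H)(K)) = E_φ ⊗ K`), `mem_adjoin_baseChange_endAlg_iff_mem_span'` (the two spellings of `E_φ ⊗ K` agree —
  proved here from the double centralizer, independently of the tree's copy in `Motives/HodgeStructureLefschetzGroupExteriorInvariants`).
* §3 THE CENTRE ON `K`-POINTS: **`mem_center_centralizer_endAlg_baseChange_iff`** (`z ∈ C(H)(K)` is central iff `↑z ∈ E_φ ⊗ K`),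
  `map_val_center_centralizer_endAlg_baseChange_eq` (`Z(C(H)(K)) = (E_φ ⊗ K) ⊓ C(H)(K)` in `End_K(K ⊗ V)`),
  **`toSubmodule_map_val_center_centralizer_endAlg_baseChange_eq_span`** (`Z(C(H)(K)) = span_K {z_K | z ∈ E_φ ∩ C(H)}` —
  «`Z(C'(A)) = C₀(A) ⊗_k k'`»), `baseChange_mem_center_centralizer_endAlg_baseChange` (`z_K` is central for `z ∈ Z(C(H))`).
* §4 THE SIMPLE CASE ON `K`-POINTS: **`isSimpleRing_centralizer_endAlg_baseChange_iff`** (`C(H)(K)` simple iff `E_φ ⊗ K` simple),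
  **`finrank_adjoin_baseChange_endAlg_mul_finrank_centralizer_endAlg_baseChange`** (`dim_K(E_φ ⊗ K) · dim_K C(H)(K) = (dim_ℚ V)²`
  when `E_φ ⊗ K` is simple).
-/

noncomputable section

open scoped TensorProduct

namespace Literature.AlgebraicGeometry.Motives

namespace HodgeStructure

universe u uK

variable (K : Type uK) [Field K] [Algebra ℚ K] {V : Type u} [AddCommGroup V] [Module ℚ V] {n : ℤ} (H : HodgeStructure V n)

/-- The commutant of a set is the commutant of the algebra it generates (elementary; used to pass between the two spellings
`{a_K}` and `E_φ ⊗ K = K[a_K]`). [folklore] -/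
private theorem centralizer_coe_adjoin_eq₅₄ {R : Type*} {A : Type*} [CommSemiring R] [Semiring A] [Algebra R A] (s : Set A) :
    Subalgebra.centralizer R (Algebra.adjoin R s : Set A) = Subalgebra.centralizer R s := by
  refine le_antisymm (fun z hz => ?_) (fun z hz => ?_)
  · rw [Subalgebra.mem_centralizer_iff] at hz ⊢
    exact fun g hg => hz g (Algebra.subset_adjoin hg)
  · rw [Subalgebra.mem_centralizer_iff] at hz ⊢
    intro g hg
    have hle : Algebra.adjoin R s ≤ Subalgebra.centralizer R {z} := Algebra.adjoin_le fun x hx => by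
      rw [SetLike.mem_coe, Subalgebra.mem_centralizer_iff]
      intro y hy
      rw [Set.mem_singleton_iff.1 hy]
      exact (hz x hx).symm
    exact ((Subalgebra.mem_centralizer_iff R).1 (hle hg) z rfl).symm

/-- The two spellings of the generating set of `E_φ ⊗ K`: the image of `E_φ` under `a ↦ a_K` is the range of `a ↦ a_K` on the
subtype. [folklore] -/
private theorem image_baseChange_endAlg_eq_range₅₄ :
    (fun a : Module.End ℚ V => a.baseChange K) '' (H.endAlg : Set (Module.End ℚ V)) =
      Set.range fun a : H.endAlg => (a : Module.End ℚ V).baseChange K := by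
  ext f
  simp only [Set.mem_image, Set.mem_range, SetLike.mem_coe, Subtype.exists, exists_prop]

/-- For `V = 0` the `K`-points of Milne's centralizer form the zero ring. [folklore] -/
private theorem subsingleton_centralizer_endAlg_baseChange_of_subsingleton [Subsingleton V] :
    Subsingleton (Subalgebra.centralizer K
      ((fun a : Module.End ℚ V => a.baseChange K) '' (H.endAlg : Set (Module.End ℚ V)))) :=
  ⟨fun _ _ => Subtype.ext (LinearMap.ext fun v => by rw [Subsingleton.elim v 0, map_zero, map_zero])⟩

/-- `γ ∈ C(H) ⟹ γ_K ∈ C(H)(K)` (private copy of the tree's `baseChange_mem_centralizer_endAlg_baseChange`,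
`Motives/HodgeStructureRestrictionIsomorphismsBaseChange`, to keep the imports of this file small).
[cite: Milne1999LefschetzClasses, §1 Remark 1.6 (p. 644)] -/
private theorem baseChange_mem_centralizer_endAlg_baseChange₅₄ {γ : Module.End ℚ V}
    (hγ : γ ∈ Subalgebra.centralizer ℚ (H.endAlg : Set (Module.End ℚ V))) :
    γ.baseChange K ∈
      Subalgebra.centralizer K ((fun a : Module.End ℚ V => a.baseChange K) '' (H.endAlg : Set (Module.End ℚ V))) := by
  simpa only [one_smul] using smul_baseChange_mem_centralizer_endAlg_baseChange K H (1 : K) hγ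

set_option maxSynthPendingDepth 4 in
/-- `C(H)(K)` is a free `K`-module (a `K`-vector space; recorded because instance search needs a raised pending depth on this
carrier). [cite: Milne1999LefschetzClasses, §1 Remark 1.6 (p. 644)] -/
theorem free_centralizer_endAlg_baseChange :
    Module.Free K (Subalgebra.centralizer K
      ((fun a : Module.End ℚ V => a.baseChange K) '' (H.endAlg : Set (Module.End ℚ V)))) :=
  Module.Free.of_divisionRing K _

variable [Module.Finite ℚ V]

/-- `End_K(K ⊗_ℚ V)` is a simple ring for `V ≠ 0` (`≅ M_d(K)`, `d = dim_ℚ V = dim_K (K ⊗ V)`). [folklore] -/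
private theorem isSimpleRing_moduleEnd_baseChange₅₄ [Nontrivial V] : IsSimpleRing (Module.End K (K ⊗[ℚ] V)) := by
  have hd : 0 < Module.finrank K (K ⊗[ℚ] V) := by
    rw [Module.finrank_baseChange]
    exact Module.finrank_pos
  haveI : Nonempty (Fin (Module.finrank K (K ⊗[ℚ] V))) := ⟨⟨0, hd⟩⟩
  exact IsSimpleRing.of_ringEquiv (LinearMap.toMatrixAlgEquiv (Module.finBasis K (K ⊗[ℚ] V))).symm.toRingEquiv inferInstance

/-! ## §1 `C(H)(K)` is semisimple -/

set_option maxSynthPendingDepth 4 in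
/-- **`C(A) ⊗_k K` IS A SEMISIMPLE `K`-ALGEBRA FOR EVERY FIELD `K ⊇ ℚ`**: for a polarizable `ℚ`-Hodge structure `H` on a
finite-dimensional `V`, the `K`-points `C(H)(K) ⊆ End_K(K ⊗_ℚ V)` of Milne's centralizer form a semisimple ring — `C(H)(K)` is
`K ⊗_ℚ C(H)` (Remark 1.6, the tree's `exists_baseChange_centralizer_algEquiv`), `C(H)` is semisimple (g54-#1
`isSemisimpleRing_centralizer_endAlg`), and semisimplicity survives extension of scalars in characteristic `0` (Milne's argument of
Remark 1.2; Pierce §10.7).  This is the algebra `(C(A) ⊗ K, †)` whose unitary group is `S(A)(K)` («reductive … cf. Weil 1960»).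
[cite: Milne1999LefschetzClasses, §1 Remark 1.2 (p. 643), Remark 1.6 (p. 644) and p. 644 L22–L24] [cite: Pierce1982, §10.7 Cor. b and §10.6 Cor.]
[cite: Zarhin2018SuperellipticJacobians, §4 Thm. 4.1 (arXiv p. 10)] -/
theorem isSemisimpleRing_centralizer_endAlg_baseChange (hH : H.IsPolarizable) :
    IsSemisimpleRing (Subalgebra.centralizer K
      ((fun a : Module.End ℚ V => a.baseChange K) '' (H.endAlg : Set (Module.End ℚ V)))) := by
  haveI : IsSemisimpleRing (Subalgebra.centralizer ℚ (H.endAlg : Set (Module.End ℚ V))) :=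
    isSemisimpleRing_centralizer_endAlg H hH
  haveI : Module.Finite ℚ (Subalgebra.centralizer ℚ (H.endAlg : Set (Module.End ℚ V))) :=
    Module.Finite.of_injective (Subalgebra.val _).toLinearMap Subtype.val_injective
  haveI : IsSemisimpleRing (K ⊗[ℚ] Subalgebra.centralizer ℚ (H.endAlg : Set (Module.End ℚ V))) :=
    Literature.RingTheory.SimpleModule.isSemisimpleRing_baseChange ℚ
      (Subalgebra.centralizer ℚ (H.endAlg : Set (Module.End ℚ V))) K
  obtain ⟨e, -⟩ := exists_baseChange_centralizer_algEquiv K H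
  exact e.toRingEquiv.isSemisimpleRing

/-! ## §2 Remark 1.2 on `K`-points, without `[HodgeTensorFacts]` -/

/-- **Remark 1.2 on `K`-points** (printed route; the tree's `forall_centralizer_endAlg_baseChange_comm_iff_mem_span_baseChange_endAlg`
without its instance hypothesis `[HodgeTensorFacts]`): for polarizable `H`, a `K`-linear endomorphism `f` of `K ⊗ V` commutes with
every `c_K`, `c ∈ C(H)`, iff `f ∈ E_φ ⊗ K = span_K {a_K | a ∈ E_φ}` (centralizers commute with extension of scalars — the tree's
`forall_baseChange_comm_iff_mem_span_baseChange_centralizer` — and `Z_{End_ℚ(V)}(C(H)) = E_φ`, g54-#1 `centralizer_centralizer_endAlg_eq'`).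
[cite: Milne1999LefschetzClasses, §1 Remark 1.2 (p. 643) and Remark 1.6 (p. 644)] [cite: Deligne1982HodgeCycles, I §3 Prop. 3.1 (proof: extension of scalars)] -/
theorem forall_centralizer_endAlg_baseChange_comm_iff_mem_span_baseChange_endAlg' (hH : H.IsPolarizable)
    (f : Module.End K (K ⊗[ℚ] V)) :
    (∀ c ∈ Subalgebra.centralizer ℚ (H.endAlg : Set (Module.End ℚ V)), f * c.baseChange K = c.baseChange K * f) ↔
      f ∈ Submodule.span K (Set.range fun a : H.endAlg => (a : Module.End ℚ V).baseChange K) := by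
  have hset : (Set.range fun a : H.endAlg => (a : Module.End ℚ V).baseChange K) =
      (fun c : Module.End ℚ V => c.baseChange K) ''
        (Subalgebra.centralizer ℚ ((Subalgebra.centralizer ℚ (H.endAlg : Set (Module.End ℚ V))) :
          Set (Module.End ℚ V)) : Set (Module.End ℚ V)) := by
    rw [centralizer_centralizer_endAlg_eq' H hH, image_baseChange_endAlg_eq_range₅₄ K H]
  rw [hset]
  exact forall_baseChange_comm_iff_mem_span_baseChange_centralizer K
    ((Subalgebra.centralizer ℚ (H.endAlg : Set (Module.End ℚ V))) : Set (Module.End ℚ V)) f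

omit [Module.Finite ℚ V] in
/-- **`C(H)(K)` is the commutant of the ALGEBRA `E_φ ⊗ K = K[a_K | a ∈ E_φ]`** (not only of its generators `a_K`): «the centralizer
of `End⁰(A) ⊗_ℚ k` in `End_k(V(A))`». [cite: Milne1999LefschetzClasses, §1 p. 643 L1–L3 (`C(A) = End_{End⁰(A) ⊗ k}(V(A))`)] -/
theorem centralizer_coe_adjoin_baseChange_endAlg_eq :
    Subalgebra.centralizer K ((Algebra.adjoin K
        (Set.range fun a : H.endAlg => (a : Module.End ℚ V).baseChange K)) : Set (Module.End K (K ⊗[ℚ] V))) =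
      Subalgebra.centralizer K ((fun a : Module.End ℚ V => a.baseChange K) '' (H.endAlg : Set (Module.End ℚ V))) := by
  rw [centralizer_coe_adjoin_eq₅₄, image_baseChange_endAlg_eq_range₅₄ K H]

/-- **REMARK 1.2 ON `K`-POINTS AS AN EQUALITY OF `K`-ALGEBRAS: `Z_{End_K(K ⊗ V)}(C(H)(K)) = E_φ ⊗ K`** — the commutant of the
`K`-points of Milne's centralizer is the `K`-algebra `K[a_K | a ∈ E_φ]` generated by the base-changed Hodge endomorphisms
(polarizable `H`; `⊇` by definition of `C(H)(K)`, `⊆` by Remark 1.2 on `K`-points: commuting with the `c_K ∈ C(H)(K)` already forces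
membership in `span_K {a_K} ⊆ K[a_K]`). [cite: Milne1999LefschetzClasses, §1 Remark 1.2 (p. 643) and Remark 1.6 (p. 644)]
[cite: Zarhin2018SuperellipticJacobians, §4 Thm. 4.1 (arXiv p. 10)] -/
theorem centralizer_centralizer_endAlg_baseChange_eq_adjoin (hH : H.IsPolarizable) :
    Subalgebra.centralizer K ((Subalgebra.centralizer K
        ((fun a : Module.End ℚ V => a.baseChange K) '' (H.endAlg : Set (Module.End ℚ V)))) : Set (Module.End K (K ⊗[ℚ] V))) =
      Algebra.adjoin K (Set.range fun a : H.endAlg => (a : Module.End ℚ V).baseChange K) := by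
  refine le_antisymm (fun f hf => ?_) (Algebra.adjoin_le ?_)
  · refine Algebra.span_le_adjoin K _ ?_
    rw [← forall_centralizer_endAlg_baseChange_comm_iff_mem_span_baseChange_endAlg' K H hH f]
    intro c hc
    exact ((Subalgebra.mem_centralizer_iff K).1 hf (c.baseChange K)
      (baseChange_mem_centralizer_endAlg_baseChange₅₄ K H hc)).symm
  · rintro _ ⟨a, rfl⟩
    rw [SetLike.mem_coe, Subalgebra.mem_centralizer_iff]
    intro g hg
    exact ((Subalgebra.mem_centralizer_iff K).1 hg _ ⟨a, a.2, rfl⟩).symm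

/-- **The two spellings of `E_φ ⊗ K` agree: `K[a_K | a ∈ E_φ]` has underlying `K`-module `span_K {a_K}`** (here from the double
centralizer on `K`-points, for polarizable `H`; the tree's `mem_adjoin_baseChange_endAlg_iff_mem_span` of
`Motives/HodgeStructureLefschetzGroupExteriorInvariants` proves it for every `H` by multiplicativity of `a ↦ a_K`).
[cite: Milne1999LefschetzClasses, §1 Remark 1.2 (p. 643) and Remark 1.6 (p. 644)] -/
theorem mem_adjoin_baseChange_endAlg_iff_mem_span' (hH : H.IsPolarizable) (f : Module.End K (K ⊗[ℚ] V)) :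
    f ∈ Algebra.adjoin K (Set.range fun a : H.endAlg => (a : Module.End ℚ V).baseChange K) ↔
      f ∈ Submodule.span K (Set.range fun a : H.endAlg => (a : Module.End ℚ V).baseChange K) := by
  refine ⟨fun hf => ?_, fun hf => Algebra.span_le_adjoin K _ hf⟩
  rw [← centralizer_centralizer_endAlg_baseChange_eq_adjoin K H hH, Subalgebra.mem_centralizer_iff] at hf
  rw [← forall_centralizer_endAlg_baseChange_comm_iff_mem_span_baseChange_endAlg' K H hH f]
  intro c hc
  exact (hf (c.baseChange K) (baseChange_mem_centralizer_endAlg_baseChange₅₄ K H hc)).symm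

/-! ## §3 The centre on `K`-points: `Z(C(H)(K)) = (E_φ ⊗ K) ∩ C(H)(K) = Z(E_φ) ⊗ K` -/

/-- **A MEMBER OF `C(H)(K)` IS CENTRAL IFF IT LIES IN `E_φ ⊗ K`** (polarizable `H`): `z ∈ C(H)(K)` commutes with `C(H)(K)` iff
`z ∈ Z_{End_K(K ⊗ V)}(C(H)(K)) = K[a_K | a ∈ E_φ]`. [cite: Milne1999LefschetzClasses, §1 Remark 1.2 (p. 643) and Remark 1.6 (p. 644)]
[cite: Zarhin2018SuperellipticJacobians, §4 Thm. 4.1 (arXiv p. 10: "the centers of ℬ and 𝒵_𝒜(ℬ) do coincide")] -/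
theorem mem_center_centralizer_endAlg_baseChange_iff (hH : H.IsPolarizable)
    (z : Subalgebra.centralizer K ((fun a : Module.End ℚ V => a.baseChange K) '' (H.endAlg : Set (Module.End ℚ V)))) :
    z ∈ Subalgebra.center K (Subalgebra.centralizer K
        ((fun a : Module.End ℚ V => a.baseChange K) '' (H.endAlg : Set (Module.End ℚ V)))) ↔
      (z : Module.End K (K ⊗[ℚ] V)) ∈
        Algebra.adjoin K (Set.range fun a : H.endAlg => (a : Module.End ℚ V).baseChange K) := by
  rw [Subalgebra.mem_center_iff, ← centralizer_centralizer_endAlg_baseChange_eq_adjoin K H hH, Subalgebra.mem_centralizer_iff]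
  constructor
  · intro h g hg
    exact congrArg Subtype.val (h ⟨g, hg⟩)
  · intro h b
    exact Subtype.ext (h b b.2)

/-- **`Z(C(H)(K)) = (E_φ ⊗ K) ⊓ C(H)(K)` inside `End_K(K ⊗ V)`** (polarizable `H`).
[cite: Milne1999LefschetzClasses, §1 Remark 1.2 (p. 643) and Remark 1.6 (p. 644)] [cite: Zarhin2018SuperellipticJacobians, §4 Thm. 4.1 (arXiv p. 10)] -/
theorem map_val_center_centralizer_endAlg_baseChange_eq (hH : H.IsPolarizable) :
    (Subalgebra.center K (Subalgebra.centralizer K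
        ((fun a : Module.End ℚ V => a.baseChange K) '' (H.endAlg : Set (Module.End ℚ V))))).map
        (Subalgebra.centralizer K ((fun a : Module.End ℚ V => a.baseChange K) '' (H.endAlg : Set (Module.End ℚ V)))).val =
      Algebra.adjoin K (Set.range fun a : H.endAlg => (a : Module.End ℚ V).baseChange K) ⊓
        Subalgebra.centralizer K ((fun a : Module.End ℚ V => a.baseChange K) '' (H.endAlg : Set (Module.End ℚ V))) := by
  refine SetLike.ext fun x => ?_
  rw [Subalgebra.mem_map, Algebra.mem_inf]
  constructor
  · rintro ⟨z, hz, rfl⟩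
    exact ⟨(mem_center_centralizer_endAlg_baseChange_iff K H hH z).1 hz, z.2⟩
  · rintro ⟨hxE, hxC⟩
    exact ⟨⟨x, hxC⟩, (mem_center_centralizer_endAlg_baseChange_iff K H hH ⟨x, hxC⟩).2 hxE, rfl⟩

/-- **«`Z(C'(A)) = C₀(A) ⊗_k k'`»: THE CENTRE OF `C(H)(K)` IS THE `K`-SPAN OF THE `z_K`, `z ∈ Z(E_φ) = E_φ ∩ C(H)`** (polarizable `H`):
an `x ∈ End_K(K ⊗ V)` lies in `(E_φ ⊗ K) ∩ C(H)(K)` iff it commutes with every `a_K` (`a ∈ E_φ`) and every `c_K` (`c ∈ C(H)`), iff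
(centralizers commute with extension of scalars) `x ∈ span_K {z_K | z ∈ Z_{End_ℚ(V)}(E_φ ∪ C(H)) = C(H) ∩ E_φ}`.
[cite: Milne1999LefschetzClasses, §1 Remark 1.2 (p. 643), Remark 1.6 (p. 644) and §1 p. 645 L4–L6 (`C₀`)]
[cite: Deligne1982HodgeCycles, I §3 Prop. 3.1 (proof: extension of scalars)] -/
theorem toSubmodule_map_val_center_centralizer_endAlg_baseChange_eq_span (hH : H.IsPolarizable) :
    Subalgebra.toSubmodule ((Subalgebra.center K (Subalgebra.centralizer K
        ((fun a : Module.End ℚ V => a.baseChange K) '' (H.endAlg : Set (Module.End ℚ V))))).map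
        (Subalgebra.centralizer K ((fun a : Module.End ℚ V => a.baseChange K) '' (H.endAlg : Set (Module.End ℚ V)))).val) =
      Submodule.span K ((fun z : Module.End ℚ V => z.baseChange K) ''
        ((H.endAlg ⊓ Subalgebra.centralizer ℚ (H.endAlg : Set (Module.End ℚ V)) :
          Subalgebra ℚ (Module.End ℚ V)) : Set (Module.End ℚ V))) := by
  -- `Z_{End_ℚ(V)}(E_φ ∪ C(H)) = Z(C(H)) ⊓ C(H) = E_φ ⊓ C(H)` (Remark 1.2)
  have hcen : Subalgebra.centralizer ℚ ((H.endAlg : Set (Module.End ℚ V)) ∪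
      (Subalgebra.centralizer ℚ (H.endAlg : Set (Module.End ℚ V)) : Set (Module.End ℚ V))) =
        H.endAlg ⊓ Subalgebra.centralizer ℚ (H.endAlg : Set (Module.End ℚ V)) := by
    refine SetLike.ext fun y => ?_
    rw [Algebra.mem_inf, Subalgebra.mem_centralizer_iff]
    constructor
    · intro h
      exact ⟨(mem_endAlg_iff_forall_centralizer_endAlg_comm' H hH y).2 fun c hc => h c (Or.inr hc),
        (Subalgebra.mem_centralizer_iff ℚ).2 fun g hg => h g (Or.inl hg)⟩
    · rintro ⟨hE, hC⟩ g (hg | hg)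
      · exact (Subalgebra.mem_centralizer_iff ℚ).1 hC g hg
      · exact (mem_endAlg_iff_forall_centralizer_endAlg_comm' H hH y).1 hE g hg
  refine Submodule.ext fun x => ?_
  rw [Subalgebra.mem_toSubmodule, map_val_center_centralizer_endAlg_baseChange_eq K H hH, Algebra.mem_inf, ← hcen,
    ← forall_baseChange_comm_iff_mem_span_baseChange_centralizer K _ x]
  constructor
  · rintro ⟨hxE, hxC⟩ s (hs | hs)
    · exact ((Subalgebra.mem_centralizer_iff K).1 hxC _ ⟨s, hs, rfl⟩).symm
    · rw [← centralizer_centralizer_endAlg_baseChange_eq_adjoin K H hH] at hxE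
      exact ((Subalgebra.mem_centralizer_iff K).1 hxE _ (baseChange_mem_centralizer_endAlg_baseChange₅₄ K H hs)).symm
  · intro h
    refine ⟨?_, ?_⟩
    · exact Algebra.span_le_adjoin K _
        ((forall_centralizer_endAlg_baseChange_comm_iff_mem_span_baseChange_endAlg' K H hH x).1 fun c hc => h c (Or.inr hc))
    · rw [Subalgebra.mem_centralizer_iff]
      rintro _ ⟨a, ha, rfl⟩
      exact (h a (Or.inl ha)).symm

/-- **`z_K` is central in `C(H)(K)` for every `z ∈ Z(C(H))`** (the generators of `Z(C(H)(K)) = Z(C(H)) ⊗ K`): `z ∈ E_φ ∩ C(H)`, so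
`z_K ∈ (E_φ ⊗ K) ∩ C(H)(K)`. [cite: Milne1999LefschetzClasses, §1 Remark 1.6 (p. 644)] -/
theorem baseChange_mem_center_centralizer_endAlg_baseChange (hH : H.IsPolarizable)
    {z : Subalgebra.centralizer ℚ (H.endAlg : Set (Module.End ℚ V))}
    (hz : z ∈ Subalgebra.center ℚ (Subalgebra.centralizer ℚ (H.endAlg : Set (Module.End ℚ V)))) :
    (⟨(z : Module.End ℚ V).baseChange K, baseChange_mem_centralizer_endAlg_baseChange₅₄ K H z.2⟩ :
        Subalgebra.centralizer K ((fun a : Module.End ℚ V => a.baseChange K) '' (H.endAlg : Set (Module.End ℚ V)))) ∈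
      Subalgebra.center K (Subalgebra.centralizer K
        ((fun a : Module.End ℚ V => a.baseChange K) '' (H.endAlg : Set (Module.End ℚ V)))) := by
  rw [mem_center_centralizer_endAlg_baseChange_iff K H hH]
  rw [mem_center_centralizer_endAlg_iff H hH] at hz
  exact Algebra.subset_adjoin ⟨⟨(z : Module.End ℚ V), hz⟩, rfl⟩

/-! ## §4 The simple case on `K`-points -/

set_option maxSynthPendingDepth 4 in
/-- **`C(H)(K)` IS SIMPLE IFF `E_φ ⊗ K` IS SIMPLE** (polarizable `H`, any field `K ⊇ ℚ`): Voight Prop. 7.7.8 (a) over `F = K` in the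
central simple `End_K(K ⊗ V)` in both directions — `C(H)(K) = Z(E_φ ⊗ K)` and `Z(C(H)(K)) = E_φ ⊗ K` (Remark 1.2 on `K`-points).
(For `V = 0` both sides fail.)  E.g. for `K` containing the Galois closure of the centre of `E_φ` neither side is simple unless that
centre is `ℚ` — Milne's splitting `F ⊗_ℚ k = F₁ × ⋯ × F_t`, `C(A) = C₁ × ⋯ × C_t` (§2 p. 646, p. 648).
[cite: Milne1999LefschetzClasses, §1 Remark 1.2 and §2 pp. 646–648] [cite: Voight2021, §7.7 Prop. 7.7.8 (a)] -/
theorem isSimpleRing_centralizer_endAlg_baseChange_iff (hH : H.IsPolarizable) :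
    IsSimpleRing (Subalgebra.centralizer K
        ((fun a : Module.End ℚ V => a.baseChange K) '' (H.endAlg : Set (Module.End ℚ V)))) ↔
      IsSimpleRing (Algebra.adjoin K (Set.range fun a : H.endAlg => (a : Module.End ℚ V).baseChange K)) := by
  rcases subsingleton_or_nontrivial V with hV | hV
  · haveI := subsingleton_centralizer_endAlg_baseChange_of_subsingleton K H
    haveI : Subsingleton (Algebra.adjoin K (Set.range fun a : H.endAlg => (a : Module.End ℚ V).baseChange K)) :=
      ⟨fun _ _ => Subtype.ext (LinearMap.ext fun v => by rw [Subsingleton.elim v 0, map_zero, map_zero])⟩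
    constructor
    · intro h
      haveI := h
      exact absurd (inferInstance : Nontrivial (Subalgebra.centralizer K
        ((fun a : Module.End ℚ V => a.baseChange K) '' (H.endAlg : Set (Module.End ℚ V))))) (not_nontrivial _)
    · intro h
      haveI := h
      exact absurd (inferInstance : Nontrivial
        (Algebra.adjoin K (Set.range fun a : H.endAlg => (a : Module.End ℚ V).baseChange K))) (not_nontrivial _)
  · haveI : IsSimpleRing (Module.End K (K ⊗[ℚ] V)) := isSimpleRing_moduleEnd_baseChange₅₄ K
    constructor
    · intro h
      haveI := h
      have h' := Literature.RingTheory.CentralSimple.isSimpleRing_centralizer (F := K)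
        (Subalgebra.centralizer K ((fun a : Module.End ℚ V => a.baseChange K) '' (H.endAlg : Set (Module.End ℚ V))))
      exact IsSimpleRing.of_ringEquiv
        (Subalgebra.equivOfEq _ _ (centralizer_centralizer_endAlg_baseChange_eq_adjoin K H hH)).toRingEquiv h'
    · intro h
      haveI := h
      have h' := Literature.RingTheory.CentralSimple.isSimpleRing_centralizer (F := K)
        (Algebra.adjoin K (Set.range fun a : H.endAlg => (a : Module.End ℚ V).baseChange K))
      exact IsSimpleRing.of_ringEquiv
        (Subalgebra.equivOfEq _ _ (centralizer_coe_adjoin_baseChange_endAlg_eq K H)).toRingEquiv h'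

set_option maxSynthPendingDepth 4 in
/-- **`dim_K (E_φ ⊗ K) · dim_K C(H)(K) = (dim_ℚ V)²` WHEN `E_φ ⊗ K` IS SIMPLE** (Voight Prop. 7.7.8 (b) over `F = K` for the simple
subalgebra `E_φ ⊗ K ⊆ End_K(K ⊗ V)`, whose commutant is `C(H)(K)`; `dim_K End_K(K ⊗ V) = (dim_K (K ⊗ V))² = (dim_ℚ V)²`).
[cite: Milne1999LefschetzClasses, §2 pp. 645–648] [cite: Voight2021, §7.7 Prop. 7.7.8 (b)] -/
theorem finrank_adjoin_baseChange_endAlg_mul_finrank_centralizer_endAlg_baseChange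
    (hE : IsSimpleRing (Algebra.adjoin K (Set.range fun a : H.endAlg => (a : Module.End ℚ V).baseChange K))) :
    Module.finrank K (Algebra.adjoin K (Set.range fun a : H.endAlg => (a : Module.End ℚ V).baseChange K)) *
        Module.finrank K (Subalgebra.centralizer K
          ((fun a : Module.End ℚ V => a.baseChange K) '' (H.endAlg : Set (Module.End ℚ V)))) =
      Module.finrank ℚ V * Module.finrank ℚ V := by
  rcases subsingleton_or_nontrivial V with hV | hV
  · haveI : Subsingleton (Algebra.adjoin K (Set.range fun a : H.endAlg => (a : Module.End ℚ V).baseChange K)) :=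
      ⟨fun _ _ => Subtype.ext (LinearMap.ext fun v => by rw [Subsingleton.elim v 0, map_zero, map_zero])⟩
    haveI := hE
    exact absurd (inferInstance : Nontrivial
      (Algebra.adjoin K (Set.range fun a : H.endAlg => (a : Module.End ℚ V).baseChange K))) (not_nontrivial _)
  · haveI : IsSimpleRing (Module.End K (K ⊗[ℚ] V)) := isSimpleRing_moduleEnd_baseChange₅₄ K
    haveI := hE
    rw [← centralizer_coe_adjoin_baseChange_endAlg_eq K H,
      Literature.RingTheory.CentralSimple.finrank_mul_finrank_centralizer (F := K)
        (Algebra.adjoin K (Set.range fun a : H.endAlg => (a : Module.End ℚ V).baseChange K)),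
      Module.finrank_linearMap, Module.finrank_baseChange]

end HodgeStructure

end Literature.AlgebraicGeometry.Motives
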